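import Summits.QuantumFields.YangMills.Theorems.BalabanUVNodesN16LeftChartDictionary
import HarnessLib

/-!
# Route «BalabanUVNodes» (cluster K4 «SpineRates»), Track-A DAG node N16 = NE3 — THE N05 → N16 EDGE STATED GEOMETRY-NEUTRALLY: N16 consumes ONLY
# [B8] THEOREM 4's OUTPUT AT THE MINIMISER PAIR in print's letters (a unitary PERIODIC gauge `u` with the torus restriction (1.29), the left chart
# `U₁ = e^{iηA′}` with its sup ∕ gradient letters) plus the displayed residuals on the END direction — NO `Thm4At`, NO `Concl`, NO capstone

Cell `pub-ymgap`, seat `pub-ymgap-dag-n16-a` (KNIT-BY-NAME, HUMAN RULING D-0062; chair R424 venue), generation 3, file 7.  `bears_on: R4∕N16 · edge N05 → N16`.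
Filed `--supports stmt-QuantumFields-19182`.  ANSWERS seat n16-b's located hazard [N16B-CENSUS + INTERFACE-GAP-1] (pub-ymgap INBOX l.10819): the tree's typed
interface `B8Eq119TwistedAxial.Thm4At L k η c₁ G a M ρ Reg Restr Concl` HARD-WIRES [Balaban1985RegularSpaces] Prop 6's CUBE geometry (`Ω_j := cube L a M ρ k`,
`Λ_j := LamP …`), whereas THE END reads the TORUS case `Ω_j = T_η` (admitted in print, p. 77) — so the binder (T4) of files 3∕4∕6 (`Thm4At … (Restr129 L k (Λ k)) …`,
`Λ k k = univ`) asks the torus conclusion from cube-local hypotheses: OVER-STRONG, never the edge of record.  HERE the edge is the OUTPUT itself.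

THE OUTPUT BINDER (OUT), per level `k ≥ 1`, datum `V ∈ dom`, minimiser pair `(U_A, U_B)` with `U_B` `(b, g)`-regular, `W := rescale L (bavg L U_B)`,
`u₀ := ptw L W U_A k`, `η := (Lᵏ)⁻¹`, `P := N·Lᵏ`: THERE IS a gauge `u`, unitary and `P`-periodic, with (1.29) `Restr129 L k Λ W u` for some `Λ` with `Λ k = univ`
(the torus restriction), and a bond field `A′`, bondwise self-adjoint and `P`-periodic, with «`U₁ = U′^{u⁻¹} = e^{iηA′}`» read as `mgauge W u (cfgExp η A′) =
pert (U_A^{u₀}) W`, (1.62)∕(1.36) `‖A′‖ ≤ s`, `‖∇^η_{W,μ}A′_κ‖ ≤ g′`; AND, for `Z := Ad_{W⁻¹}(iηA′)`, the residual members (1.38) `IsLandauB8 L N k W Z`, the Hölder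
member (`s₂`, `β`) and the `D*D` member (`s₁`) — [Balaban1985RegularSpaces] Thm 4∕Thm 2 + Prop 3 OUTPUT TYPE at the pair, torus geometry, asserted by nobody.
§1 `pairLandauGaugeB8Avg_of_thm4Output` (any `d ≥ 1`): (OUT) ∧ (H3ˢᵘᵖ) ∧ letters ⟹ `PairLandauGaugeB8Avg d (sfClass d L N ε) L N b g s₁ s₂ β dom` — file 6's
`landauRepB8_of_leftChart` (n16-b's F3) ∘ file 2's source `PairDbarB8.dbar_of_restr129_pair` (n16-b's g0); `W` unitary∕periodic∕small from `RegularSup (k+1) U_B`,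
`u₀` unitary∕periodic from `B8Eq166ConstraintPair.pinnedTwistedFix_global ∕ ptw_periodic`.
§2 `n16_of_thm4Output` (`d = 4`): the record knit with the constant of record — `∃ r > 0, ∀ g > 0, ∃ C ≥ 0, ∀ b′ c′` on THREE ε-free leaf lines ((Rb), the `c′`-line,
`b′ + 226·320²·b′² < α₁` with the DISPLAYED absolute letter `α₁ = min {1∕(3C₀(4)), c₂′(4,L)∕2}`), `∀ 0 < ε ≤ r, 0 ≤ s₁ ≤ r, 0 ≤ b ≤ ε∕2`, `∀ g′` on the ε-free line
`g′ + 2(b′ + 226·320²·b′²)·s₁ ≤ s₁`, `∀ s₂ dom`: (OUT) at `(s₁, g′, s₂, β = 1)` → `LeafH3sup 4 L N ε b′ c′ dom` → `NE3EnergyRateWCov 4 (sfClass 4 L N ε) L N b g C s₁ s₂ dom`.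
Whatever typed Theorem 4 N05's hand lands (cube, torus or `{Ω_j}`-parametric), it instantiates (OUT) from that theorem + the pair's KERNEL hypotheses
(`PairClassAkB8`, `PairAxialGaugeB8`, `B8Thm4HypothesesPair`, `PairReg335B8`); n16-b's dictionaries F2–F5 serve unchanged.
§3 `ne3Shape_of_thm4Output` (`d = 4`): the DECL column likewise — g2's `ne3Shape_of_inEdges` with the N05 interface replaced by (OUT).

HONEST FRAMING.  Bookkeeping over LANDED theorems by name; (OUT) is [Balaban1985RegularSpaces] Thm 4∕Thm 2 + Prop 3 OUTPUT TYPE at curved backgrounds — NOT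
proved anywhere in the tree; (H3ˢᵘᵖ) = N07's [Balaban1985Variational] Thm 1 (8)+(10) TYPE; **N16 ∕ NE3 is NOT discharged**; count-neutral; one finite four-torus
at fixed ε — NOT ℝ⁴, NOT infinite volume, NOT OS, NOT a mass gap, NOT Clay.
-/

set_option autoImplicit false

open scoped BigOperators Matrix Matrix.Norms.L2Operator
open NormedSpace

namespace Summit.QuantumFields.YangMills.BalabanUVNodes.N16

open Literature.MathematicalPhysics.QuantumFieldTheory.Balaban1983to89
open B7Prop1Explicit B7Prop2Explicit
open T4AveragingDeficitWall (IsUnitaryCfg SmallField Ad IsSkewDir vary fineAction blockSites)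
open T4AveragingDeficitWallBoundary (IsPeriodicCfg periodBox)
open T4EtaRateMin (NE3Shape)
open B8Lemma1NonAbelian (pert)
open B7Eq92Concrete (mgauge)
open B8Ineq132 (covDerivFwd)
open B8Eq146AExpansion (iEta)
open B8Eq184Proof (cfgExp)
open B8Eq119TwistedAxial (Restr129)
open B8Eq166ConstraintPair (ptw ptw_periodic pinnedTwistedFix_global)
open B12Ineq417Flat (shiftCfg)
open Summit.QuantumFields.BalabanUV.T4Continuum
open MinimalActionSandwich (IsMinimiser)
open MinimalActionRate (Regular sfClass rescale_bavg_mem_sfClass minActReadings)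
open MinimalActionRefine (RegularSup gradConst)
open BlockAverageCurrent (curConst curConst_nonneg)
open NE3EnergyShapes (IsUnitarySite IsPeriodicSite)
open NE3EnergyWeightedCovShape (NE3EnergyRateWCov)
open NE3RightInverseSupLetters (frameC)
open NE3.PairLandauB8 (LandauRepB8 IsLandauB8 covLapDir)
open NE3.PairLandauB8Avg (PairLandauGaugeB8Avg)
open NE3.LeafIndexSockets (LeafH3sup)
open NE3.RemainderTowerPrepB8 (shiftCfg_of_isPeriodicCfg)
open NE3.SupplierB8SfClassPrep (pdev_le_of_smallField)
open NE3.PairDbarB8 (dbar_of_restr129_pair)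

noncomputable section

variable {d : ℕ} {n : Type*} [Fintype n] [DecidableEq n]

/-! ## §1 `PairLandauGaugeB8Avg` from Theorem 4's OUTPUT at the pair (any dimension, torus geometry) -/

/-- **`PairLandauGaugeB8Avg` FROM [B8] THM 4's OUTPUT AT THE PAIR — GEOMETRY-NEUTRAL EDGE** (`d ≥ 1`, `L ≥ 2`; class radius `ε ≥ 0`; class regularity letter
`b` with `512(d+1)(d+4)L²b ≤ 1`, `b + 226(8(d+1)(d+4))²b² < α`; sup letters `(b′, c′)` with (Rb) and `b′ + 226(8(d+1)(d+4))²b′² < α`; ONE letter `α > ε` with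
`C₀α ≤ ⅓`, `2α ≤ c₂′` (the pinned axial pre-gauge's regime — nothing else); left-chart letters `0 ≤ s ≤ s₁`, `g′` with `g′ + 2(b′ + 226(8(d+1)(d+4))²b′²)·s ≤ s₁`).
(OUT) ∧ (H3ˢᵘᵖ) ⟹ `PairLandauGaugeB8Avg d (sfClass d L N ε) L N b g s₁ s₂ β dom`.  No existence is proved: (OUT) is the hypothesis. [folklore] -/
theorem pairLandauGaugeB8Avg_of_thm4Output [Nonempty n] (hd : 1 ≤ d) {L N : ℕ} (hL : 2 ≤ L) {ε b g b' c' α s g' s₁ s₂ β : ℝ}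
    (hε : 0 ≤ ε) (hb : 0 ≤ b) (hbs : 512 * (d + 1) * (d + 4) * (L : ℝ) ^ 2 * b ≤ 1)
    (hbα : b + 226 * (8 * (d + 1) * (d + 4)) ^ 2 * b ^ 2 < α)
    (hb' : 0 ≤ b') (hRb : 2 ^ 15 * ((d : ℝ) + 1) ^ 2 * ((d : ℝ) + 4) ^ 2 * (L : ℝ) ^ 2 * b' ≤ 1)
    (hb'α : b' + 226 * (8 * (d + 1) * (d + 4)) ^ 2 * b' ^ 2 < α)
    (hα : 0 < α) (hεα : ε < α) (hα3 : C0 d * α ≤ 1 / 3) (hα2 : 2 * α ≤ c2' d L)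
    (hs0 : 0 ≤ s) (hsup : s ≤ s₁) (hgrad : g' + 2 * (b' + 226 * (8 * (d + 1) * (d + 4)) ^ 2 * b' ^ 2) * s ≤ s₁)
    {dom : Set (Site d → Fin d → (Matrix n n ℂ)ˣ)}
    (hOut : ∀ k : ℕ, 1 ≤ k → ∀ V ∈ dom, ∀ UA UB : Site d → Fin d → (Matrix n n ℂ)ˣ,
      IsMinimiser d (sfClass d L N ε) L N k V UA → IsMinimiser d (sfClass d L N ε) L N (k + 1) V UB → Regular d L N b g (k + 1) UB →
      ∃ u : Site d → (Matrix n n ℂ)ˣ, (∀ x, u x ∈ unitaryUnits (Matrix n n ℂ)) ∧ IsPeriodicSite u ((N * L ^ k : ℕ) : ℤ) ∧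
        (∃ Λ : ℕ → Set (Site d), Λ k = Set.univ ∧ Restr129 L k Λ (rescale L (bavg L UB)) u) ∧
        ∃ A : Site d → Fin d → Matrix n n ℂ,
          (∀ x μ, IsSelfAdjoint (A x μ)) ∧ (∀ (x : Site d) (κ μ : Fin d), A (x + ((N * L ^ k : ℕ) : ℤ) • e κ) μ = A x μ) ∧
          mgauge (rescale L (bavg L UB)) u (cfgExp (((L : ℝ) ^ k)⁻¹) A)
            = pert (gaugeAct (ptw L (rescale L (bavg L UB)) UA k) UA) (rescale L (bavg L UB)) ∧
          (∀ x μ, ‖A x μ‖ ≤ s) ∧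
          (∀ (μ : Fin d) (x : Site d) (κ : Fin d), ‖covDerivFwd (((L : ℝ) ^ k)⁻¹) (rescale L (bavg L UB)) μ (fun z => A z κ) x‖ ≤ g') ∧
          IsLandauB8 L N k (rescale L (bavg L UB)) (fun x μ => Ad (rescale L (bavg L UB) x μ)⁻¹ (iEta (((L : ℝ) ^ k)⁻¹) A x μ)) ∧
          (∀ (κ μ : Fin d) (y : Site d),
            ‖Ad (rescale L (bavg L UB) (y + e κ) μ)
                (Ad (rescale L (bavg L UB) (y + e κ + e μ) μ)
                    ((fun x μ => Ad (rescale L (bavg L UB) x μ)⁻¹ (iEta (((L : ℝ) ^ k)⁻¹) A x μ)) (y + (2 : ℕ) • e μ) κ)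
                  - (fun x μ => Ad (rescale L (bavg L UB) x μ)⁻¹ (iEta (((L : ℝ) ^ k)⁻¹) A x μ)) (y + e μ) κ)
              - (Ad (rescale L (bavg L UB) (y + e κ) μ) ((fun x μ => Ad (rescale L (bavg L UB) x μ)⁻¹ (iEta (((L : ℝ) ^ k)⁻¹) A x μ)) (y + e μ) κ)
                - (fun x μ => Ad (rescale L (bavg L UB) x μ)⁻¹ (iEta (((L : ℝ) ^ k)⁻¹) A x μ)) y κ)‖
              ≤ s₂ * (((L : ℝ)⁻¹) ^ k) ^ ((2 : ℝ) + β)) ∧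
          (∀ (x : Site d) (κ : Fin d),
            ‖covLapDir (rescale L (bavg L UB)) (fun x μ => Ad (rescale L (bavg L UB) x μ)⁻¹ (iEta (((L : ℝ) ^ k)⁻¹) A x μ)) x κ‖
              ≤ s₁ * (((L : ℝ)⁻¹) ^ k) ^ 3))
    (h3 : LeafH3sup d L N ε b' c' dom) :
    PairLandauGaugeB8Avg d (sfClass d L N ε) L N b g s₁ s₂ β dom := by
  intro k hk V hV UA UB hA hB hreg
  letI : CStarAlgebra (Matrix n n ℂ) := {}
  have hL1 : 1 ≤ L := le_trans (by norm_num) hL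
  have hL1r : (1 : ℝ) ≤ L := by exact_mod_cast hL1
  have hLk : (1 : ℝ) ≤ (L : ℝ) ^ k := one_le_pow₀ hL1r
  obtain ⟨u, hu, huP, ⟨Λ, hΛ, hres⟩, A, hAsa, hAP, hmg, hs, hg, hlan, hhol, hlap⟩ := hOut k hk V hV UA UB hA hB hreg
  set W : Site d → Fin d → (Matrix n n ℂ)ˣ := rescale L (bavg L UB) with hWdef
  set αW : ℝ := b' + 226 * (8 * (d + 1) * (d + 4)) ^ 2 * b' ^ 2 with hαWdef
  have hαW0 : 0 ≤ αW := by rw [hαWdef]; positivity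
  -- the pair's background from (H3ˢᵘᵖ) at `U_B`: unitary, periodic, small-field of radius `α_W ξ²ᵏ`
  have hregB : RegularSup d L N b' c' (k + 1) UB := h3 V hV k UB hB
  have hbs' : 512 * (d + 1) * (d + 4) * (L : ℝ) ^ 2 * b' ≤ 1 := by
    have h1 : (512 : ℝ) * (d + 1) * (d + 4) * (L : ℝ) ^ 2 * b' ≤ 2 ^ 15 * ((d : ℝ) + 1) ^ 2 * ((d : ℝ) + 4) ^ 2 * (L : ℝ) ^ 2 * b' := by
      have hd0 : (0 : ℝ) ≤ d := Nat.cast_nonneg d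
      have : (512 : ℝ) * (d + 1) * (d + 4) ≤ 2 ^ 15 * ((d : ℝ) + 1) ^ 2 * ((d : ℝ) + 4) ^ 2 := by nlinarith
      have hL2b : 0 ≤ (L : ℝ) ^ 2 * b' := by positivity
      nlinarith
    linarith
  obtain ⟨hWu, hWP, hWsm⟩ := rescale_bavg_mem_sfClass hL1 hb' hbs' le_rfl hregB.regular
  -- `u₀ = ptw L W U_A k`: unitary and periodic
  obtain ⟨hAu, hAuP, hAsm⟩ := hA.mem.1
  have hG := avgClosed_unitaryUnits d (𝔸 := Matrix n n ℂ) L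
  have h34 : pdev UA < α * (((L : ℝ) ^ k)⁻¹) ^ 2 := by
    refine (pdev_le_of_smallField (div_nonneg hε (by positivity)) hAsm).trans_lt ?_
    rw [inv_pow, ← div_eq_mul_inv]; exact div_lt_div_of_pos_right hεα (by positivity)
  have h33 : pdev W < α * (((L : ℝ) ^ k)⁻¹) ^ 2 := by
    refine (pdev_le_of_smallField (div_nonneg hαW0 (by positivity)) hWsm).trans_lt ?_
    rw [inv_pow, ← div_eq_mul_inv]; exact div_lt_div_of_pos_right hb'α (by positivity)
  obtain ⟨hu₀G, -, -, -, -, -⟩ := pinnedTwistedFix_global L hL hG k W UA hWu hAu hα hα3 hα2 h33 h34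
  have hAshift : ∀ i : Fin d, shiftCfg (((N * L ^ k : ℕ) : ℤ) • e i) UA = UA := fun i => shiftCfg_of_isPeriodicCfg hAuP (e i)
  have hWshift : ∀ i : Fin d, shiftCfg (((N * L ^ k : ℕ) : ℤ) • e i) W = W := fun i => shiftCfg_of_isPeriodicCfg hWP (e i)
  have hu₀P : IsPeriodicSite (ptw L W UA k) ((N * L ^ k : ℕ) : ℤ) := fun x i => ptw_periodic hL1 N k hWshift hAshift x i
  -- the letters at `η = (Lᵏ)⁻¹`
  have hη : (0 : ℝ) < ((L : ℝ) ^ k)⁻¹ := by positivity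
  have hηk : ((L : ℝ) ^ k)⁻¹ = ((L : ℝ)⁻¹) ^ k := (inv_pow _ _).symm
  have hη1 : ((L : ℝ) ^ k)⁻¹ ≤ 1 := inv_le_one_of_one_le₀ hLk
  have hgrad' : (((L : ℝ) ^ k)⁻¹) ^ 2 * g' + 2 * (αW / ((L : ℝ) ^ k) ^ 2) * ((((L : ℝ) ^ k)⁻¹) * s) ≤ s₁ * (((L : ℝ) ^ k)⁻¹) ^ 2 := by
    have e : (((L : ℝ) ^ k)⁻¹) ^ 2 * g' + 2 * (αW / ((L : ℝ) ^ k) ^ 2) * ((((L : ℝ) ^ k)⁻¹) * s)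
        = (((L : ℝ) ^ k)⁻¹) ^ 2 * (g' + 2 * αW * s * ((L : ℝ) ^ k)⁻¹) := by
      field_simp
    rw [e, mul_comm s₁]
    refine mul_le_mul_of_nonneg_left ?_ (by positivity)
    have h1 : 2 * αW * s * ((L : ℝ) ^ k)⁻¹ ≤ 2 * αW * s := mul_le_of_le_one_right (by positivity) hη1
    linarith
  -- the Landau representative from the left chart (file 6 §1) and (1.37) from (1.29) (n16-b's g0 `PairDbarB8`)
  obtain ⟨hLR, htrans⟩ := landauRepB8_of_leftChart (s₂ := s₂) (β := β) rfl hWu hWP (div_nonneg hαW0 (by positivity)) hWsm hu huP hu₀G hu₀P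
    hη hηk hAsa hAP hmg hs hg hsup hgrad' rfl hlan hhol hlap
  exact ⟨u⁻¹ * ptw L W UA k, _, hLR, dbar_of_restr129_pair hd hL hA hB hreg hε hb hbs hα hεα hbα hα3 hα2 htrans hΛ hres⟩

/-! ## §2 The `d = 4` record knit over Theorem 4's OUTPUT at the pair -/

/-- **N16 · NE3 BY NAME FROM [B8] THM 4's OUTPUT AT THE PAIR AND N07's INTERFACE — THE EDGE OF RECORD ON N16's SIDE** (`d = 4`; `L ≥ 2`, `N ≥ 1`).  With the
DISPLAYED absolute letter `α₁ = min {1∕(3C₀(4)), c₂′(4,L)∕2}` (the pinned axial pre-gauge's regime — no Theorem-4 constant enters): there is `r > 0` (function of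
`(L, N, n)`) such that for every `g > 0` there is ONE `C ≥ 0` (function of `(L, N, n, g)`) such that for all leaf letters `0 ≤ b′, c′` on THREE ε-free lines — (Rb),
the `c′`-line, `b′ + 226·320²·b′² < α₁` — every `0 < ε ≤ r`, `0 ≤ s₁ ≤ r`, `0 ≤ b ≤ ε∕2`, every gradient letter `g′` on the ε-free line `g′ + 2(b′ + 226·320²·b′²)·s₁ ≤ s₁`,
every `s₂` and `dom`: (OUT) at `(s₁, g′, s₂, β = 1)` → `LeafH3sup 4 L N ε b′ c′ dom` → `NE3EnergyRateWCov 4 (sfClass 4 L N ε) L N b g C s₁ s₂ dom` (= `YMDAG.N16 …`).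
File 1's `n16_constant_of_record` ∘ §1 (`r` shrunk by `α₁∕2` and file 2's four radii).  N16 ∕ NE3 NOT proved: (OUT) and (H3ˢᵘᵖ) are the hypotheses. [folklore] -/
theorem n16_of_thm4Output [Nonempty n] {L N : ℕ} (hL : 2 ≤ L) (hN : 1 ≤ N) :
    ∃ r : ℝ, 0 < r ∧ ∀ ⦃g : ℝ⦄, 0 < g → ∃ C : ℝ, 0 ≤ C ∧ ∀ ⦃b' c' : ℝ⦄, 0 ≤ b' → 0 ≤ c' →
      2 ^ 15 * ((4 : ℝ) + 1) ^ 2 * ((4 : ℝ) + 4) ^ 2 * (L : ℝ) ^ 2 * b' ≤ 1 →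
      23040 * (4 : ℝ) ^ 4 * (frameC 4 L + 4) ^ 3 * (c' + curConst 4 L * b' ^ 2) ≤ 1 →
      b' + 226 * (8 * ((4 : ℝ) + 1) * ((4 : ℝ) + 4)) ^ 2 * b' ^ 2 < min (1 / (3 * C0 4)) (c2' 4 L / 2) →
      ∀ ⦃ε s₁ b : ℝ⦄, 0 < ε → ε ≤ r → 0 ≤ s₁ → s₁ ≤ r → 0 ≤ b → b ≤ ε / 2 →
      ∀ ⦃g' : ℝ⦄, g' + 2 * (b' + 226 * (8 * ((4 : ℝ) + 1) * ((4 : ℝ) + 4)) ^ 2 * b' ^ 2) * s₁ ≤ s₁ → ∀ (s₂ : ℝ)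
      {dom : _root_.Set (Site 4 → Fin 4 → (Matrix n n ℂ)ˣ)},
        (∀ k : ℕ, 1 ≤ k → ∀ V ∈ dom, ∀ UA UB : Site 4 → Fin 4 → (Matrix n n ℂ)ˣ,
          IsMinimiser 4 (sfClass 4 L N ε) L N k V UA → IsMinimiser 4 (sfClass 4 L N ε) L N (k + 1) V UB → Regular 4 L N b g (k + 1) UB →
          ∃ u : Site 4 → (Matrix n n ℂ)ˣ, (∀ x, u x ∈ unitaryUnits (Matrix n n ℂ)) ∧ IsPeriodicSite u ((N * L ^ k : ℕ) : ℤ) ∧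
            (∃ Λ : ℕ → Set (Site 4), Λ k = Set.univ ∧ Restr129 L k Λ (rescale L (bavg L UB)) u) ∧
            ∃ A : Site 4 → Fin 4 → Matrix n n ℂ,
              (∀ x μ, IsSelfAdjoint (A x μ)) ∧ (∀ (x : Site 4) (κ μ : Fin 4), A (x + ((N * L ^ k : ℕ) : ℤ) • e κ) μ = A x μ) ∧
              mgauge (rescale L (bavg L UB)) u (cfgExp (((L : ℝ) ^ k)⁻¹) A)
                = pert (gaugeAct (ptw L (rescale L (bavg L UB)) UA k) UA) (rescale L (bavg L UB)) ∧
              (∀ x μ, ‖A x μ‖ ≤ s₁) ∧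
              (∀ (μ : Fin 4) (x : Site 4) (κ : Fin 4), ‖covDerivFwd (((L : ℝ) ^ k)⁻¹) (rescale L (bavg L UB)) μ (fun z => A z κ) x‖ ≤ g') ∧
              IsLandauB8 L N k (rescale L (bavg L UB)) (fun x μ => Ad (rescale L (bavg L UB) x μ)⁻¹ (iEta (((L : ℝ) ^ k)⁻¹) A x μ)) ∧
              (∀ (κ μ : Fin 4) (y : Site 4),
                ‖Ad (rescale L (bavg L UB) (y + e κ) μ)
                    (Ad (rescale L (bavg L UB) (y + e κ + e μ) μ)
                        ((fun x μ => Ad (rescale L (bavg L UB) x μ)⁻¹ (iEta (((L : ℝ) ^ k)⁻¹) A x μ)) (y + (2 : ℕ) • e μ) κ)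
                      - (fun x μ => Ad (rescale L (bavg L UB) x μ)⁻¹ (iEta (((L : ℝ) ^ k)⁻¹) A x μ)) (y + e μ) κ)
                  - (Ad (rescale L (bavg L UB) (y + e κ) μ)
                      ((fun x μ => Ad (rescale L (bavg L UB) x μ)⁻¹ (iEta (((L : ℝ) ^ k)⁻¹) A x μ)) (y + e μ) κ)
                    - (fun x μ => Ad (rescale L (bavg L UB) x μ)⁻¹ (iEta (((L : ℝ) ^ k)⁻¹) A x μ)) y κ)‖
                  ≤ s₂ * (((L : ℝ)⁻¹) ^ k) ^ ((2 : ℝ) + 1)) ∧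
              (∀ (x : Site 4) (κ : Fin 4),
                ‖covLapDir (rescale L (bavg L UB)) (fun x μ => Ad (rescale L (bavg L UB) x μ)⁻¹ (iEta (((L : ℝ) ^ k)⁻¹) A x μ)) x κ‖
                  ≤ s₁ * (((L : ℝ)⁻¹) ^ k) ^ 3)) →
        LeafH3sup 4 L N ε b' c' dom →
        NE3EnergyRateWCov 4 (sfClass 4 L N ε) L N b g C s₁ s₂ dom := by
  have hL1 : 1 ≤ L := by omega
  obtain ⟨r, hr0, hr⟩ := n16_constant_of_record (n := n) hL hN
  -- the displayed absolute letter `α₁` (pinned axial pre-gauge's regime)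
  set α : ℝ := min (1 / (3 * C0 4)) (c2' 4 L / 2) with hαdef
  have hC0 : 0 < C0 4 := C0_pos 4
  have hc2 : 0 < c2' 4 L := c2'_pos 4 L hL1
  have hα0 : 0 < α := lt_min (by positivity) (by positivity)
  have hα1 : α ≤ 1 / (3 * C0 4) := min_le_left _ _
  have hα2' : α ≤ c2' 4 L / 2 := min_le_right _ _
  -- file 2's four radii at `d = 4`
  obtain ⟨R₁, hR₁⟩ : ∃ R : ℝ, R = 1 / (6 * C0 4 + 1) := ⟨_, rfl⟩
  obtain ⟨R₃, hR₃⟩ : ∃ R : ℝ, R = 1 / (226 * (8 * ((4 : ℝ) + 1) * ((4 : ℝ) + 4)) ^ 2 + 1) := ⟨_, rfl⟩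
  obtain ⟨R₄, hR₄⟩ : ∃ R : ℝ, R = 1 / (256 * ((4 : ℝ) + 1) * ((4 : ℝ) + 4) * (L : ℝ) ^ 2 + 1) := ⟨_, rfl⟩
  have hR₁0 : 0 < R₁ := by rw [hR₁]; positivity
  have hR₃0 : 0 < R₃ := by rw [hR₃]; positivity
  have hR₄0 : 0 < R₄ := by rw [hR₄]; positivity
  refine ⟨min r (min (α / 2) (min R₁ (min (c2' 4 L / 4) (min R₃ R₄)))),
    lt_min hr0 (lt_min (by positivity) (lt_min hR₁0 (lt_min (by positivity) (lt_min hR₃0 hR₄0)))), fun g hg => ?_⟩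
  obtain ⟨C, hC0', hC⟩ := hr hg
  refine ⟨C, hC0', fun b' c' hb' hc' hRb hcF hb'α ε s₁ b hε hεr hs₁ hs₁r hb hbh g' hgrad s₂ dom hOut h3 => ?_⟩
  have hεr' : ε ≤ r := hεr.trans (min_le_left _ _)
  have hεα2 : ε ≤ α / 2 := hεr.trans ((min_le_right _ _).trans (min_le_left _ _))
  have hε1 : ε ≤ R₁ := hεr.trans ((min_le_right _ _).trans ((min_le_right _ _).trans (min_le_left _ _)))
  have hε2 : ε ≤ c2' 4 L / 4 := hεr.trans ((min_le_right _ _).trans ((min_le_right _ _).trans ((min_le_right _ _).trans (min_le_left _ _))))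
  have hε3 : ε ≤ R₃ :=
    hεr.trans ((min_le_right _ _).trans ((min_le_right _ _).trans ((min_le_right _ _).trans ((min_le_right _ _).trans (min_le_left _ _)))))
  have hε4 : ε ≤ R₄ :=
    hεr.trans ((min_le_right _ _).trans ((min_le_right _ _).trans ((min_le_right _ _).trans ((min_le_right _ _).trans (min_le_right _ _)))))
  have hs₁r' : s₁ ≤ r := hs₁r.trans (min_le_left _ _)
  have h1 : (6 * C0 4 + 1) * ε ≤ 1 := by
    rw [hR₁, le_div_iff₀ (by positivity)] at hε1; linarith
  have h2 : 4 * ε ≤ c2' 4 L := by linarith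
  have h3' : (226 * (8 * (((4 : ℕ) : ℝ) + 1) * (((4 : ℕ) : ℝ) + 4)) ^ 2 + 1) * ε ≤ 1 := by
    rw [hR₃, le_div_iff₀ (by positivity)] at hε3; push_cast; linarith
  have h4' : (256 * (((4 : ℕ) : ℝ) + 1) * (((4 : ℕ) : ℝ) + 4) * (L : ℝ) ^ 2 + 1) * ε ≤ 1 := by
    rw [hR₄, le_div_iff₀ (by positivity)] at hε4; push_cast; linarith
  -- the class letter `b` and the class radius against `α`
  obtain ⟨-, -, hbα2, -, -, hbs⟩ := restrRegime_of_small 4 L hε hb hbh h1 h2 h3' h4'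
  have hεα : ε < α := by linarith
  have hbα : b + 226 * (8 * ((4 : ℕ) + 1 : ℝ) * ((4 : ℕ) + 4 : ℝ)) ^ 2 * b ^ 2 < α := by
    have : b + 226 * (8 * ((4 : ℕ) + 1 : ℝ) * ((4 : ℕ) + 4 : ℝ)) ^ 2 * b ^ 2 < 2 * ε := by simpa using hbα2
    linarith
  have hA3 : C0 4 * α ≤ 1 / 3 := by
    rw [le_div_iff₀ (by positivity)] at hα1; linarith
  have hA2 : 2 * α ≤ c2' 4 L := by linarith
  have hRb' : 2 ^ 15 * ((((4 : ℕ) : ℝ)) + 1) ^ 2 * ((((4 : ℕ) : ℝ)) + 4) ^ 2 * (L : ℝ) ^ 2 * b' ≤ 1 := by simpa only [Nat.cast_ofNat] using hRb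
  have hb'α' : b' + 226 * (8 * ((4 : ℕ) + 1 : ℝ) * ((4 : ℕ) + 4 : ℝ)) ^ 2 * b' ^ 2 < α := by simpa using hb'α
  have hgrad' : g' + 2 * (b' + 226 * (8 * ((4 : ℕ) + 1 : ℝ) * ((4 : ℕ) + 4 : ℝ)) ^ 2 * b' ^ 2) * s₁ ≤ s₁ := by simpa using hgrad
  exact hC hb' hc' hRb hcF hε hεr' hs₁ hs₁r' hb hbh s₂
    (pairLandauGaugeB8Avg_of_thm4Output (by norm_num) hL hε.le hb hbs hbα hb' hRb' hb'α' hα0 hεα hA3 hA2 hs₁ le_rfl hgrad' hOut h3) h3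

/-! ## §3 The DECL column over Theorem 4's OUTPUT at the pair -/

/-- **N16 · THE ROW's DECL `T4EtaRateMin.NE3Shape` FROM [B8] THM 4's OUTPUT AT THE PAIR AND N07's INTERFACE** (`d = 4`; `L ≥ 2`, `N ≥ 1`; `α₁` as in §2) — g2's
`BalabanUVNodesN16ShapeKnit.ne3Shape_of_inEdges` (its numeric regime verbatim, `r` shrunk by `α₁∕2` and file 2's four radii; N05's regularity letter
`g := gradConst 4 c`) with the N05 interface REPLACED by (OUT) at `(s₁, g′, s₂, β = 1)` plus the two ε-free lines `b + 226·320²·b² < α₁`,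
`g′ + 2(b + 226·320²·b²)·s₁ ≤ s₁`; conclusion verbatim (a regular selection exists; for every such selection `∃ C′ ≥ 0, NE3Shape (minActReadings …) C′ (L⁻¹)`).
§1 ∘ g2.  N16 ∕ NE3 NOT proved. [folklore] -/
theorem ne3Shape_of_thm4Output [Nonempty n] {L N : ℕ} (hL : 2 ≤ L) (hN : 1 ≤ N) :
    ∃ r : ℝ, 0 < r ∧ ∀ ⦃ε s₁ t b c ε₁ : ℝ⦄, 0 < ε → ε ≤ r → 0 ≤ s₁ → s₁ ≤ r →
      0 ≤ b → b ≤ t → 0 < c → c ≤ t →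
      (2 : ℝ) ^ 91 * (L : ℝ) ^ 17 * t ≤ 1 → (2 : ℝ) ^ 76 * (L : ℝ) ^ 12 * t ≤ ε →
      16 * C0 4 * ε ≤ 3 → 1024 * (4 + 1) * (4 + 4) * (L : ℝ) ^ 2 * ε ≤ 1 → b ≤ ε / 2 →
      23040 * (4 : ℝ) ^ 4 * (frameC 4 L + 4) ^ 3 * (c + curConst 4 L * b ^ 2) ≤ 1 →
      b + 226 * (8 * ((4 : ℝ) + 1) * ((4 : ℝ) + 4)) ^ 2 * b ^ 2 < min (1 / (3 * C0 4)) (c2' 4 L / 2) →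
      ε₁ ≤ 1 / 4 → ε₁ ≤ b → 4 * ε₁ ≤ c →
      ∀ ⦃g' : ℝ⦄, g' + 2 * (b + 226 * (8 * ((4 : ℝ) + 1) * ((4 : ℝ) + 4)) ^ 2 * b ^ 2) * s₁ ≤ s₁ → ∀ (s₂ : ℝ)
      {dom : Set (Site 4 → Fin 4 → (Matrix n n ℂ)ˣ)}, dom ⊆ sfClass 4 L N ε₁ 0 →
        (∀ k : ℕ, 1 ≤ k → ∀ V ∈ dom, ∀ UA UB : Site 4 → Fin 4 → (Matrix n n ℂ)ˣ,
          IsMinimiser 4 (sfClass 4 L N ε) L N k V UA → IsMinimiser 4 (sfClass 4 L N ε) L N (k + 1) V UB → Regular 4 L N b (gradConst 4 c) (k + 1) UB →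
          ∃ u : Site 4 → (Matrix n n ℂ)ˣ, (∀ x, u x ∈ unitaryUnits (Matrix n n ℂ)) ∧ IsPeriodicSite u ((N * L ^ k : ℕ) : ℤ) ∧
            (∃ Λ : ℕ → Set (Site 4), Λ k = Set.univ ∧ Restr129 L k Λ (rescale L (bavg L UB)) u) ∧
            ∃ A : Site 4 → Fin 4 → Matrix n n ℂ,
              (∀ x μ, IsSelfAdjoint (A x μ)) ∧ (∀ (x : Site 4) (κ μ : Fin 4), A (x + ((N * L ^ k : ℕ) : ℤ) • e κ) μ = A x μ) ∧
              mgauge (rescale L (bavg L UB)) u (cfgExp (((L : ℝ) ^ k)⁻¹) A)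
                = pert (gaugeAct (ptw L (rescale L (bavg L UB)) UA k) UA) (rescale L (bavg L UB)) ∧
              (∀ x μ, ‖A x μ‖ ≤ s₁) ∧
              (∀ (μ : Fin 4) (x : Site 4) (κ : Fin 4), ‖covDerivFwd (((L : ℝ) ^ k)⁻¹) (rescale L (bavg L UB)) μ (fun z => A z κ) x‖ ≤ g') ∧
              IsLandauB8 L N k (rescale L (bavg L UB)) (fun x μ => Ad (rescale L (bavg L UB) x μ)⁻¹ (iEta (((L : ℝ) ^ k)⁻¹) A x μ)) ∧
              (∀ (κ μ : Fin 4) (y : Site 4),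
                ‖Ad (rescale L (bavg L UB) (y + e κ) μ)
                    (Ad (rescale L (bavg L UB) (y + e κ + e μ) μ)
                        ((fun x μ => Ad (rescale L (bavg L UB) x μ)⁻¹ (iEta (((L : ℝ) ^ k)⁻¹) A x μ)) (y + (2 : ℕ) • e μ) κ)
                      - (fun x μ => Ad (rescale L (bavg L UB) x μ)⁻¹ (iEta (((L : ℝ) ^ k)⁻¹) A x μ)) (y + e μ) κ)
                  - (Ad (rescale L (bavg L UB) (y + e κ) μ)
                      ((fun x μ => Ad (rescale L (bavg L UB) x μ)⁻¹ (iEta (((L : ℝ) ^ k)⁻¹) A x μ)) (y + e μ) κ)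
                    - (fun x μ => Ad (rescale L (bavg L UB) x μ)⁻¹ (iEta (((L : ℝ) ^ k)⁻¹) A x μ)) y κ)‖
                  ≤ s₂ * (((L : ℝ)⁻¹) ^ k) ^ ((2 : ℝ) + 1)) ∧
              (∀ (x : Site 4) (κ : Fin 4),
                ‖covLapDir (rescale L (bavg L UB)) (fun x μ => Ad (rescale L (bavg L UB) x μ)⁻¹ (iEta (((L : ℝ) ^ k)⁻¹) A x μ)) x κ‖
                  ≤ s₁ * (((L : ℝ)⁻¹) ^ k) ^ 3)) →
        LeafH3sup 4 L N ε b c dom →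
        (∃ sel : ℕ → (Site 4 → Fin 4 → (Matrix n n ℂ)ˣ) → (Site 4 → Fin 4 → (Matrix n n ℂ)ˣ),
            ∀ V ∈ dom, ∀ k : ℕ, IsMinimiser 4 (sfClass 4 L N ε) L N k V (sel k V) ∧ RegularSup 4 L N b c k (sel k V)) ∧
        ∀ sel : ℕ → (Site 4 → Fin 4 → (Matrix n n ℂ)ˣ) → (Site 4 → Fin 4 → (Matrix n n ℂ)ˣ),
          (∀ V ∈ dom, ∀ k : ℕ, IsMinimiser 4 (sfClass 4 L N ε) L N k V (sel k V)) →
          (∀ V ∈ dom, ∀ k : ℕ, RegularSup 4 L N b c k (sel k V)) →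
          ∃ C' : ℝ, 0 ≤ C' ∧
            NE3Shape
              (minActReadings 4 (sfClass 4 L N ε) L N dom
                (fun k V (x : ↥(periodBox (d := 4) N)) =>
                  fineAction (sel k V) (((blockSites L)^[k] {(x : Site 4)}) ×ˢ Finset.univ)))
              C' ((L : ℝ)⁻¹) := by
  have hL1 : 1 ≤ L := by omega
  obtain ⟨r, hr0, hr⟩ := ne3Shape_of_inEdges (n := n) hL hN
  set α : ℝ := min (1 / (3 * C0 4)) (c2' 4 L / 2) with hαdef
  have hC0 : 0 < C0 4 := C0_pos 4
  have hc2 : 0 < c2' 4 L := c2'_pos 4 L hL1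
  have hα0 : 0 < α := lt_min (by positivity) (by positivity)
  have hα1 : α ≤ 1 / (3 * C0 4) := min_le_left _ _
  have hα2' : α ≤ c2' 4 L / 2 := min_le_right _ _
  obtain ⟨R₁, hR₁⟩ : ∃ R : ℝ, R = 1 / (6 * C0 4 + 1) := ⟨_, rfl⟩
  obtain ⟨R₃, hR₃⟩ : ∃ R : ℝ, R = 1 / (226 * (8 * ((4 : ℝ) + 1) * ((4 : ℝ) + 4)) ^ 2 + 1) := ⟨_, rfl⟩
  obtain ⟨R₄, hR₄⟩ : ∃ R : ℝ, R = 1 / (256 * ((4 : ℝ) + 1) * ((4 : ℝ) + 4) * (L : ℝ) ^ 2 + 1) := ⟨_, rfl⟩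
  have hR₁0 : 0 < R₁ := by rw [hR₁]; positivity
  have hR₃0 : 0 < R₃ := by rw [hR₃]; positivity
  have hR₄0 : 0 < R₄ := by rw [hR₄]; positivity
  refine ⟨min r (min (α / 2) (min R₁ (min (c2' 4 L / 4) (min R₃ R₄)))),
    lt_min hr0 (lt_min (by positivity) (lt_min hR₁0 (lt_min (by positivity) (lt_min hR₃0 hR₄0)))),
    fun ε s₁ t b c ε₁ hε hεr hs₁ hs₁r hb hbt hc hct hsmall hεt hε1 hε2 hbε hcF hbα' hε₁ hε₁b hε₁c g' hgrad s₂ dom hdom hOut h3 => ?_⟩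
  have hεr' : ε ≤ r := hεr.trans (min_le_left _ _)
  have hεα2 : ε ≤ α / 2 := hεr.trans ((min_le_right _ _).trans (min_le_left _ _))
  have hεR1 : ε ≤ R₁ := hεr.trans ((min_le_right _ _).trans ((min_le_right _ _).trans (min_le_left _ _)))
  have hεR2 : ε ≤ c2' 4 L / 4 := hεr.trans ((min_le_right _ _).trans ((min_le_right _ _).trans ((min_le_right _ _).trans (min_le_left _ _))))
  have hεR3 : ε ≤ R₃ :=
    hεr.trans ((min_le_right _ _).trans ((min_le_right _ _).trans ((min_le_right _ _).trans ((min_le_right _ _).trans (min_le_left _ _)))))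
  have hεR4 : ε ≤ R₄ :=
    hεr.trans ((min_le_right _ _).trans ((min_le_right _ _).trans ((min_le_right _ _).trans ((min_le_right _ _).trans (min_le_right _ _)))))
  have hs₁r' : s₁ ≤ r := hs₁r.trans (min_le_left _ _)
  have h1 : (6 * C0 4 + 1) * ε ≤ 1 := by
    rw [hR₁, le_div_iff₀ (by positivity)] at hεR1; linarith
  have h2 : 4 * ε ≤ c2' 4 L := by linarith
  have h3' : (226 * (8 * (((4 : ℕ) : ℝ) + 1) * (((4 : ℕ) : ℝ) + 4)) ^ 2 + 1) * ε ≤ 1 := by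
    rw [hR₃, le_div_iff₀ (by positivity)] at hεR3; push_cast; linarith
  have h4' : (256 * (((4 : ℕ) : ℝ) + 1) * (((4 : ℕ) : ℝ) + 4) * (L : ℝ) ^ 2 + 1) * ε ≤ 1 := by
    rw [hR₄, le_div_iff₀ (by positivity)] at hεR4; push_cast; linarith
  obtain ⟨-, -, hbα2, -, -, hbs⟩ := restrRegime_of_small 4 L hε hb hbε h1 h2 h3' h4'
  have hεα : ε < α := by linarith
  have hbα : b + 226 * (8 * ((4 : ℕ) + 1 : ℝ) * ((4 : ℕ) + 4 : ℝ)) ^ 2 * b ^ 2 < α := by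
    have : b + 226 * (8 * ((4 : ℕ) + 1 : ℝ) * ((4 : ℕ) + 4 : ℝ)) ^ 2 * b ^ 2 < 2 * ε := by simpa using hbα2
    linarith
  have hA3 : C0 4 * α ≤ 1 / 3 := by
    rw [le_div_iff₀ (by positivity)] at hα1; linarith
  have hA2 : 2 * α ≤ c2' 4 L := by linarith
  have hL1r : (1 : ℝ) ≤ L := by exact_mod_cast hL1
  have hRb0 : 2 ^ 15 * ((4 : ℝ) + 1) ^ 2 * ((4 : ℝ) + 4) ^ 2 * (L : ℝ) ^ 2 * b ≤ 1 := by
    have h2 : (L : ℝ) ^ 2 ≤ (L : ℝ) ^ 17 := pow_le_pow_right₀ hL1r (by norm_num)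
    have e : 2 ^ 15 * ((4 : ℝ) + 1) ^ 2 * ((4 : ℝ) + 4) ^ 2 * (L : ℝ) ^ 2 * b = 52428800 * ((L : ℝ) ^ 2 * b) := by ring
    rw [e]
    have h5 : (L : ℝ) ^ 2 * b ≤ (L : ℝ) ^ 17 * t := mul_le_mul h2 hbt hb (by positivity)
    have h6 : (2 : ℝ) ^ 91 * ((L : ℝ) ^ 17 * t) ≤ 1 := by linarith [hsmall]
    have h7 : 0 ≤ (L : ℝ) ^ 17 * t := le_trans (by positivity) h5
    linarith [h5, h6, h7]
  have hRb : 2 ^ 15 * ((((4 : ℕ) : ℝ)) + 1) ^ 2 * ((((4 : ℕ) : ℝ)) + 4) ^ 2 * (L : ℝ) ^ 2 * b ≤ 1 := by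
    simpa only [Nat.cast_ofNat] using hRb0
  have hbα'' : b + 226 * (8 * ((4 : ℕ) + 1 : ℝ) * ((4 : ℕ) + 4 : ℝ)) ^ 2 * b ^ 2 < α := by simpa using hbα'
  have hgrad' : g' + 2 * (b + 226 * (8 * ((4 : ℕ) + 1 : ℝ) * ((4 : ℕ) + 4 : ℝ)) ^ 2 * b ^ 2) * s₁ ≤ s₁ := by simpa using hgrad
  exact hr hε hεr' hs₁ hs₁r' hb hbt hc hct hsmall hεt hε1 hε2 hbε hcF hε₁ hε₁b hε₁c s₂ hdom
    (pairLandauGaugeB8Avg_of_thm4Output (by norm_num) hL hε.le hb hbs hbα hb hRb hbα'' hα0 hεα hA3 hA2 hs₁ le_rfl hgrad' hOut h3) h3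

end

end Summit.QuantumFields.YangMills.BalabanUVNodes.N16
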